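import Summits.AtomisticToContinuum.HydrodynamicLimit.Theorems.MourreKoopmanChargesOneBodyCompletenessStaticIdentification
import Summits.AtomisticToContinuum.HydrodynamicLimit.Theorems.MourreKoopmanChargesStressStrongMixingTorusStressCovIdentification
import Literature.MathematicalPhysics.KineticTheory.Georgii1995HardSphereCanonicalLocalLimit
import HarnessLib

/-!
# `OneBodyCompleteness` (crux stmt-AtomisticToContinuum-9583, route `MourreKoopmanCharges`), line `registered`:
# the infinite-volume side of the torus ↔ infinite-volume identification at `s ≠ 0`

Helper file (`--supports stmt-AtomisticToContinuum-9583`) for the registered OPEN CORE #2 `stub_torusIdentificationUnit`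
of the skeleton `Cruxes/OneBodyCompleteness/Lines/birth.lean`.  The stub asserts, for a unit-diameter unit-inverse-
temperature Gibbs fluctuation datum `F` of density `σ³` carried by Alexander's flow and a profile `h ⊥ {1, v, |v|²}` in
`L²(M_θ)`, that `(N+1)·cov_{G_N(σ,θ)}(A_h(χ) ∘ Φ_{s(N+1)^{-1/3}}, A_h(χ)) → (∫χ²)·K·⟪U_{(√θ/σ)s}[A_{h_θ}], [A_{h_θ}]⟫`
(`h_θ = h(√θ·)`); its `s = 0` instance is landed (`torusIdentificationUnit_static`, `K = σ⁻³`).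

The two missing inputs of the dynamical (`s ≠ 0`) content (stated inline as the hypotheses of the reduction
`torusIdentificationUnit_of` in `…IdentificationReduction.lean`, and as named `@[conjecture]` propositions in
`…IdentificationConjectures.lean`) concern the BLOWN-UP TWO-TIME CELL PAIR FUNCTIONAL of the canonical torus gas: blow the torus configuration up by
`ε_N⁻¹ = (N+1)^{1/3}/σ` around a base point `x ∈ 𝕋³` (`blowUp`, OVY's `ω_{ε,x}`: unit spheres at density `σ³`, velocities
`M_θ`), and pair the one-body cell observable `A_h` of the cell `C + ξ` (`C = [0,1)³`) of the configuration AT TORUS TIME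
`s(N+1)^{-1/3}` (microscopic time `s/σ`) with `A_h` of the cell `C` at time `0`:

* `TwoTimeLocalLimitUnit` (I1) — the two-time local limit: for fixed `x, ξ, s` this functional converges, as `N → ∞`,
  to the corresponding two-time cell pair functional `E_{F.μ}[(A_{h_θ} ∘ τ_{-ξ} ∘ F.flow ((√θ/σ)s)) · A_{h_θ}]` of the
  datum `F` (the dynamical, two-time, one-body-observable version of the named fact
  `Georgii1995_hardSphereCanonicalLocalLimit`; content: locality in probability of the hard-sphere dynamics uniformly in
  `N` + equivalence of ensembles + `HardSphereGibbsLowDensityUniqueness` + `InfiniteHardSphereFlow.unique`; no proof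
  in print);
* `UniformTorusTwoTimeClustering` (I2) — uniform clustering: for `h ⊥ 1` the functional, with arbitrary measurable
  spatial weights `|w|, |w'| ≤ 1` inside the two cells, is dominated by ONE integrable envelope `c(ξ)` uniformly in
  `N ≥ N₀`, the base point and the weights (the torus counterpart, uniform in the size, of the clustering field
  `integrable_cov` of `F`; Spohn 1991 Part I Condition 2.1 assumes it; no proof in print; FALSE without `h ⊥ 1` by the
  canonical constraint — Lebowitz–Percus–Verlet).

This file proves the INFINITE-VOLUME SIDE of the identification: the `ξ`-integral of the limit functional of (I1) is the
matrix element of the stub, `∫ E_{F.μ}[(A_g ∘ τ_{-ξ} ∘ F.flow u) A_g] dξ = ⟪U_u [A_g], [A_g]⟫_{ℋ_F}` for `g ⊥ 1`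
(`integral_twoTimeCell_eq_inner`: both one-time means vanish by the DLR Campbell computation, the flow commutes with the
shifts a.e., the shifts preserve `F.μ`, and `⟪U_u [a], [a]⟫ = ∫ Cov(a ∘ F.flow u, a ∘ τ_ξ) dξ`).  The reduction of the
stub to (I1) ∧ (I2) (exact partition-of-unity decomposition of `(N+1)·cov` on the torus + dominated convergence) is in the
companion files `…IdentificationTorus.lean` / `…IdentificationReduction.lean`.

References: H. Spohn, *Large Scale Dynamics of Interacting Particles* (1991), Part I §2.2 Condition 2.1, §7.1
(7.6)–(7.7), (7.14)–(7.15); H.-O. Georgii, Probab. Theory Relat. Fields 99 (1995) Thms 3.3–3.4; R. Alexander, Comm.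
Math. Phys. 49 (1976) Thm 5.2, Cor. 5.4; J. L. Lebowitz, J. K. Percus, L. Verlet, Phys. Rev. 153 (1967) 250;
S. Olla, S. R. S. Varadhan, H.-T. Yau, Comm. Math. Phys. 155 (1993) §3–4.
-/

noncomputable section

namespace Summit.AtomisticToContinuum.HydrodynamicLimit.Theorems.MourreKoopmanChargesOneBodyCompleteness

open MeasureTheory ProbabilityTheory Filter Topology Set Function
open scoped ENNReal InnerProductSpace BigOperators
open Literature.Analysis.FluidPDE Literature.MathematicalPhysics.KineticTheory
open Literature.Analysis.FunctionSpaces (PointConfig)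
open Summit.AtomisticToContinuum.HydrodynamicLimit.Theorems.MourreKoopmanChargesIdealGasNoDecay
  (integral_gaussMeasure_eq_integral_mul)
open Summit.AtomisticToContinuum.HydrodynamicLimit.Theorems.MourreKoopmanChargesStressStrongMixing
  (covariance_eq_integral_mul_of_integral_eq_zero inner_koopman_fluct_self_eq_integral_cov)

/-! ### Cell observables of shifted configurations as linear statistics -/

/-- The one-body cell observable of the configuration shifted by `-ξ` is the linear statistic of the cell `C + ξ`:
`A_h(τ_{-ξ} ω) = Σ_{(q,v) ∈ ω} 1_C(q - ξ) h(v)`. [folklore] -/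
theorem cellObs_spatialShift_neg (h : V3 → ℝ) (ξ : V3) (ω : MarkedConfig) :
    cellObs h (spatialShift (-ξ) ω) =
      linStat (fun p => (unitCell : Set V3).indicator (fun _ => (1 : ℝ)) (p.1 - ξ) * h p.2) ω := by
  classical
  simp only [spatialShift_apply, cellObs, linStat, PointConfig.coe_eq_carrier, PointConfig.carrier_translate]
  rw [finsum_mem_image (add_left_injective _).injOn]
  refine finsum_mem_congr rfl fun p _ => ?_
  simp only [Prod.fst_add, Prod.snd_add, add_zero, sub_eq_add_neg]
  simp only [Set.indicator_apply]
  split_ifs <;> simp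

/-- The one-body cell observable is the linear statistic of the cell `C` with unit weight:
`A_h(ω) = Σ_{(q,v) ∈ ω} 1_C(q) h(v)`. [folklore] -/
theorem cellObs_eq_linStat_indicator (h : V3 → ℝ) (ω : MarkedConfig) :
    cellObs h ω = linStat (fun p => (unitCell : Set V3).indicator (fun _ => (1 : ℝ)) p.1 * h p.2) ω := by
  classical
  simp only [cellObs, linStat]
  refine finsum_mem_congr rfl fun p _ => ?_
  simp only [Set.indicator_apply]
  split_ifs <;> simp

/-! ### The infinite-volume side: means, the two-time cell pair functional as a covariance, and `⟪U_u ψ, ψ⟫` -/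

/-- **The one-body cell observable of a profile `g ⊥ 1` is centred** under every unit-diameter unit-inverse-
temperature DLR state (DLR Campbell computation `integral_windowStat_mul_sub_eq_zero` with the second statistic
constant). [Spohn1991 Part I §7.1 (7.6)–(7.7)] -/
theorem integral_cellObs_eq_zero_of_gibbs {z : ℝ} (hz : 0 < z) {μ : Measure MarkedConfig}
    (hG : IsHardSphereGibbs 1 z 1 (0 : V3) μ) {g : V3 → ℝ} (hg : Continuous g)
    (hb : ∃ (C : ℝ) (k : ℕ), ∀ v, |g v| ≤ C * (1 + ‖v‖) ^ k)
    (hg0 : ∫ v, g v * localMaxwellian 1 1 (0 : V3) v = 0) : ∫ ω, cellObs g ω ∂μ = 0 := by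
  classical
  obtain ⟨Cg, kg, hgg⟩ := hb
  have hG' : IsHardSphereGibbs 1 z (1 : ℝ)⁻¹ (0 : V3) μ := by rw [inv_one]; exact hG
  have h0 : ∫ v, g v ∂(gaussMeasure (0 : V3) 1) = 0 := by
    rw [integral_gaussMeasure_eq_integral_mul one_pos]; exact hg0
  have hC : MeasurableSet (unitCell : Set V3) := measurableSet_unitCell
  have hCb : Bornology.IsBounded (unitCell : Set V3) := isBounded_unitCell
  have hX : ∀ ω : MarkedConfig, cellObs g ω =
      ∑ᶠ p ∈ (ω : Set (V3 × V3)), (unitCell : Set V3).indicator (1 : V3 → ℝ) p.1 * g p.2 := fun ω => by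
    simp only [cellObs, linStat]
    refine finsum_mem_congr rfl fun p _ => ?_
    simp only [Set.indicator_apply, Pi.one_apply]
    split_ifs <;> simp
  have key := integral_windowStat_mul_sub_eq_zero hz one_pos hG' hg continuous_const hgg (e := fun _ => (0 : ℝ))
    (Ce := 1) (ke := 0) (fun v => by simp) h0 (by simp) hC hC hCb hCb (-1)
  simp only [mul_zero, finsum_mem_zero, zero_sub, neg_neg, mul_one] at key
  simp_rw [hX]
  exact key

/-- **The limit functional of (I1) is a two-time truncated correlation of the datum**: for a unit-diameter datum `F`
with DLR state at unit inverse temperature and a profile `g ⊥ 1` in `L²(M_1)`,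
`E_{F.μ}[(A_g ∘ τ_{-ξ} ∘ F.flow u) · A_g] = Cov_{F.μ}(A_g ∘ F.flow u, A_g ∘ τ_ξ)` (both means vanish; the flow commutes
with the shifts a.e.; the shift `τ_ξ` preserves `F.μ`). [Spohn1991 Part I §7.1 (7.14)–(7.15)] -/
theorem integral_cellObs_shift_flow_mul_eq_cov {z : ℝ} (hz : 0 < z) (F : HardSphereFluctuationData 1)
    (hG : IsHardSphereGibbs 1 z 1 (0 : V3) F.μ) {g : V3 → ℝ} (hg : Continuous g)
    (hb : ∃ (C : ℝ) (k : ℕ), ∀ v, |g v| ≤ C * (1 + ‖v‖) ^ k)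
    (hg0 : ∫ v, g v * localMaxwellian 1 1 (0 : V3) v = 0) (u : ℝ) (ξ : V3) :
    ∫ ω, cellObs g (spatialShift (-ξ) (F.flow u ω)) * cellObs g ω ∂F.μ =
      cov[cellObs g ∘ F.flow u, cellObs g ∘ spatialShift ξ; F.μ] := by
  have hmean : F.μ[cellObs g] = 0 := integral_cellObs_eq_zero_of_gibbs hz hG hg hb hg0
  have hflow : Measurable (F.flow u) := (F.measurePreserving_flow u).measurable
  have ha : Measurable (cellObs g) := measurable_cellObs hg.measurable
  have hT : MeasurePreserving (spatialShift (-ξ) ∘ F.flow u) F.μ F.μ :=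
    (F.measurePreserving_shift (-ξ)).comp (F.measurePreserving_flow u)
  have hmean' : F.μ[fun ω => cellObs g (spatialShift (-ξ) (F.flow u ω))] = 0 := by
    have hf' : AEStronglyMeasurable (cellObs g) (F.μ.map (spatialShift (-ξ) ∘ F.flow u)) := by
      rw [hT.map_eq]; exact ha.aestronglyMeasurable
    have e := integral_map hT.measurable.aemeasurable hf'
    rw [hT.map_eq] at e
    rw [← hmean, e]
    rfl
  rw [← covariance_eq_integral_mul_of_integral_eq_zero hmean' hmean]
  -- commute flow and shift a.e.
  have h1 : (fun ω => cellObs g (spatialShift (-ξ) (F.flow u ω))) =ᵐ[F.μ]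
      fun ω => cellObs g (F.flow u (spatialShift (-ξ) ω)) := by
    filter_upwards [F.flow_comm_shift u (-ξ)] with ω hω
    simp only [Function.comp_apply] at hω
    rw [hω]
  rw [covariance_congr_ae h1 Filter.EventuallyEq.rfl]
  -- translate both observables by `ξ`
  have hX : AEStronglyMeasurable (fun ω => cellObs g (F.flow u (spatialShift (-ξ) ω))) F.μ :=
    (ha.comp (hflow.comp (spatialShift.measurable (-ξ)))).aestronglyMeasurable
  have e2 := covariance_comp_measurePreserving (F.measurePreserving_shift ξ) hX ha.aestronglyMeasurable
  rw [← e2]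
  congr 1
  funext ω
  simp only [Function.comp_apply]
  rw [show spatialShift (-ξ) (spatialShift ξ ω) = ω from congrFun (spatialShift.neg_comp ξ) ω]

/-- **The infinite-volume side of the identification**: for `A_g ∈ 𝒱_F`, `g ⊥ 1`, the `ξ`-integral of the limit
functional of (I1) is the matrix element of the stub, `∫ E_{F.μ}[(A_g ∘ τ_{-ξ} ∘ F.flow u) A_g] dξ = ⟪U_u [A_g], [A_g]⟫`,
and the integrand is integrable (clustering field of `F`). [Spohn1991 Part I §7.1 (7.14)–(7.15)] -/
theorem integral_twoTimeCell_eq_inner {z : ℝ} (hz : 0 < z) (F : HardSphereFluctuationData 1)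
    (hG : IsHardSphereGibbs 1 z 1 (0 : V3) F.μ) {g : V3 → ℝ} (hg : Continuous g)
    (hb : ∃ (C : ℝ) (k : ℕ), ∀ v, |g v| ≤ C * (1 + ‖v‖) ^ k)
    (hg0 : ∫ v, g v * localMaxwellian 1 1 (0 : V3) v = 0) (hmem : cellObs g ∈ F.localObs) (u : ℝ) :
    Integrable (fun ξ : V3 => ∫ ω, cellObs g (spatialShift (-ξ) (F.flow u ω)) * cellObs g ω ∂F.μ) ∧
    ∫ ξ : V3, ∫ ω, cellObs g (spatialShift (-ξ) (F.flow u ω)) * cellObs g ω ∂F.μ =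
      ⟪F.koopman u (F.fluct (cellObs g)), F.fluct (cellObs g)⟫_ℝ := by
  have e : (fun ξ : V3 => ∫ ω, cellObs g (spatialShift (-ξ) (F.flow u ω)) * cellObs g ω ∂F.μ) =
      fun ξ : V3 => cov[cellObs g ∘ F.flow u, cellObs g ∘ spatialShift ξ; F.μ] :=
    funext fun ξ => integral_cellObs_shift_flow_mul_eq_cov hz F hG hg hb hg0 u ξ
  rw [e, inner_koopman_fluct_self_eq_integral_cov F hmem u]
  exact ⟨F.integrable_cov (F.comp_flow_mem u hmem) hmem, rfl⟩

/-- **The limit of the stub, infinite-volume form** (the constant is `K = σ⁻³`): with `h_θ = h(√θ·)` and `u = (√θ/σ)s`,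
`σ⁻³ · (∫χ²) · ∫ E_{F.μ}[(A_{h_θ} ∘ τ_{-ξ} ∘ F.flow u) A_{h_θ}] dξ = (∫χ²) · (σ³)⁻¹ · ⟪U_u [A_{h_θ}], [A_{h_θ}]⟫`.
[Spohn1991 Part I §7.1 (7.14)–(7.15)] -/
theorem limit_eq_inner_koopman {z σ θ : ℝ} (hz : 0 < z) (hθ : 0 < θ) (F : HardSphereFluctuationData 1)
    (hG : IsHardSphereGibbs 1 z 1 (0 : V3) F.μ) {h : V3 → ℝ} (hh : Continuous h)
    (hb : ∃ (C : ℝ) (k : ℕ), ∀ v, |h v| ≤ C * (1 + ‖v‖) ^ k)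
    (hmem : cellObs (fun w => h (Real.sqrt θ • w)) ∈ F.localObs)
    (hm0 : ∫ v, h v * localMaxwellian 1 θ (0 : V3) v = 0) (χ : T3 → ℝ) (s : ℝ) :
    (σ ^ 3)⁻¹ * ((∫ x, χ x * χ x) *
      ∫ ξ : V3, ∫ ω, cellObs (fun w => h (Real.sqrt θ • w)) (spatialShift (-ξ) (F.flow (Real.sqrt θ / σ * s) ω)) *
        cellObs (fun w => h (Real.sqrt θ • w)) ω ∂F.μ) =
    (∫ x, χ x * χ x) * (σ ^ 3)⁻¹ *
      ⟪F.koopman (Real.sqrt θ / σ * s) (F.fluct (cellObs (fun w => h (Real.sqrt θ • w)))),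
        F.fluct (cellObs (fun w => h (Real.sqrt θ • w)))⟫_ℝ := by
  have hhθ : Continuous fun w : V3 => h (Real.sqrt θ • w) := hh.comp (continuous_const_smul (Real.sqrt θ))
  have hbθ := poly_bound_comp_sqrt (θ := θ) hb
  have hm0' : ∫ w, h (Real.sqrt θ • w) * localMaxwellian 1 1 (0 : V3) w = 0 := by
    rw [← integral_mul_localMaxwellian_eq_comp_sqrt hθ h]; exact hm0
  rw [(integral_twoTimeCell_eq_inner hz F hG hhθ hbθ hm0' hmem _).2]
  ring

end Summit.AtomisticToContinuum.HydrodynamicLimit.Theorems.MourreKoopmanChargesOneBodyCompleteness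

end
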